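import Mathlib
import HarnessLib

/-!
# Route `UnthreadedDoor` / `ThreadingFlux`, crux `PoloidalLiouville` (stmt-NavierStokesRegularity-1222), antidynamo v2 skeleton,
# rung `stub_singleDegreeRung`, EVEN degree — (E1a) THE RADIAL PROFILES: from the vorticity amplitude `ĝ` to the pair `(a, k)`
# with `ĝ = a − k′/r`, the divergence relation `r a′ + (l+3)a + l k′/r = 0`, and the centre/infinity bounds

Support file (census instrument decomp-ns-census-1 g34, cell decomp-ns; `--supports stmt-NavierStokesRegularity-1222 --as helper`; 0 kit).
PURE ONE-VARIABLE ANALYSIS.  The (E1) assembly of the even rung (`singleDegreeRung_of_sliceData`, p811987, hypothesis `hE1`) needs, at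
each slice, radial profiles `a, k` on `(0,∞)` with `ĝ = a − k′/r` (hG) and `r a′ + (l+3)a + l k′/r = 0` (hdiv), `ĝ` being the vorticity
amplitude of the slice (`curl v = ĝ(‖y‖)•(∇P(y) × y)`, analytic on `(0,∞)`, `|ĝ(r)|·r^l` bounded).  THIS FILE constructs them (the
regular-at-the-centre solution of the two constitutive ODEs; the singular one is the Kelvin transform `P/r^{2l+1}`):
`F(r) := ∫₀^r s^{2l+2} ĝ(s) ds`, `a(r) := l·F(r)/r^{2l+3}`, `k(r) := k₁ + ∫₁^r s(a(s) − ĝ(s)) ds`, so that `k′ = r(a − ĝ)` (hG) and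
`r a′ = l ĝ − (2l+3)a` (hdiv) — algebra checked on paper by the critic (decomp-ns-crit-1 g8, row 378).  No auxiliary definitions:
`F a k` are arbitrary functions tied to `ĝ` by DEFINING HYPOTHESES `hF / ha / hk` (equalities of functions), discharged by `rfl` in the export.
* `moment_hasDerivAt`, `amp_hasDerivAt`, `coef_hasDerivAt` (FTC); ★ `amp_ode` (`r a′ = l ĝ − (2l+3) a`), ★ `vortAmp_eq_amp_sub` (hG),
  ★ `radial_divergence_relation` (hdiv); `moment_contDiffOn` / `amp_contDiffOn` / `coef_contDiffOn` (`ĝ ∈ C^∞ ⟹ a, k ∈ C^∞` on `(0,∞)`);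
* bounds `abs_amp_mul_pow_le` (`|a|·r^l ≤ lK`), `abs_coefDeriv_le` (`|k′(s)| ≤ (l+1)K/s^{l−1}`), `abs_coef_le_log` (`l = 2`, `k₁ = 0`:
  `|k(r)| ≤ 3K|log r|`), `abs_coef_decay_mul_pow_le` (`l ≥ 3`, `k₁ = −∫₁^∞ k′`: `|k(r)|·r^{l−2} ≤ (l+1)K/(l−2)`);
* ★★ `exists_radialProfiles` — THE EXPORT: for `l ≥ 2`, `ĝ ∈ C^∞(0,∞)` with `|ĝ(r)|·r^l ≤ K` (`r > 0`) there are `a k ∈ C^∞(0,∞)` with hG,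
  hdiv, `|a(r)|·r^l ≤ C` and `|k(r)|·r^{l−1} ≤ C·r·(1 + |log r|)` for all `r > 0` (so `V = (aP)•y + k•∇P` tends to `0` at the centre and is
  `O(r log r)` at infinity — the inputs of (E1b)).

HONEST LABEL: elementary real analysis serving the open EVEN-degree rung of an S-free Liouville engine; the rung, the wall
`stub_scalarLiouville`, `PoloidalLiouville` (1222) and Navier–Stokes regularity are NOT touched (crux 1222 is INCOMPARABLE with the summit;
descent inside the door's cone, decorative for the summit).  Nothing here proves NavierStokesRegularity. [folklore]
-/

noncomputable section

-- the summit and its single sub-problem share the name (CONVENTIONS §1), as in every Theorems file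
set_option linter.dupNamespace false

open scoped Topology ContDiff Interval
open Filter Set MeasureTheory intervalIntegral

namespace Summit.NavierStokesRegularity.NavierStokesRegularity.Theorems.PoloidalLiouville.Antidynamo

variable {l : ℕ} {ĝ F a k : ℝ → ℝ} {K k₁ : ℝ}

/-! ### The moment integrand `s^{2l+2} ĝ(s)`: bound, integrability; the moment `F` -/

/-- `|s^{2l+2} ĝ(s)| ≤ K s^{l+2}` for `s > 0` under the amplitude bound `|ĝ(s)|·s^l ≤ K`. [folklore] -/
theorem abs_momentIntegrand_le (hK : ∀ r, 0 < r → |ĝ r| * r ^ l ≤ K) {s : ℝ} (hs : 0 < s) :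
    |s ^ (2 * l + 2) * ĝ s| ≤ K * s ^ (l + 2) := by
  have h := hK s hs
  have hsl : 0 < s ^ (l + 2) := pow_pos hs _
  rw [abs_mul, abs_of_pos (pow_pos hs _), show 2 * l + 2 = l + (l + 2) by ring, pow_add]
  calc s ^ l * s ^ (l + 2) * |ĝ s| = (|ĝ s| * s ^ l) * s ^ (l + 2) := by ring
    _ ≤ K * s ^ (l + 2) := mul_le_mul_of_nonneg_right h hsl.le

/-- The amplitude bound forces `0 ≤ K`. [folklore] -/
theorem nonneg_of_ampBound (hK : ∀ r, 0 < r → |ĝ r| * r ^ l ≤ K) : 0 ≤ K :=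
  le_trans (mul_nonneg (abs_nonneg _) (pow_pos one_pos _).le) (hK 1 one_pos)
/-- The moment integrand is continuous on `(0,∞)` when `ĝ` is. [folklore] -/
theorem continuousOn_momentIntegrand (hĝ : ContinuousOn ĝ (Ioi 0)) :
    ContinuousOn (fun s : ℝ => s ^ (2 * l + 2) * ĝ s) (Ioi 0) :=
  ((continuous_id.pow _).continuousOn).mul hĝ

/-- The moment integrand is integrable on `(0, r]`: continuous there and bounded by `K r^{l+2}`. [folklore] -/
theorem intervalIntegrable_momentIntegrand (hĝ : ContinuousOn ĝ (Ioi 0)) (hK : ∀ r, 0 < r → |ĝ r| * r ^ l ≤ K) {r : ℝ}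
    (hr : 0 < r) : IntervalIntegrable (fun s : ℝ => s ^ (2 * l + 2) * ĝ s) volume 0 r := by
  rw [intervalIntegrable_iff_integrableOn_Ioc_of_le hr.le]
  have hmeas : AEStronglyMeasurable (fun s : ℝ => s ^ (2 * l + 2) * ĝ s) (volume.restrict (Ioc 0 r)) :=
    ((continuousOn_momentIntegrand hĝ).mono Ioc_subset_Ioi_self).aestronglyMeasurable measurableSet_Ioc
  refine ⟨hmeas, HasFiniteIntegral.restrict_of_bounded (K * r ^ (l + 2)) (by simp) ?_⟩
  rw [ae_restrict_iff' measurableSet_Ioc]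
  refine Eventually.of_forall fun s hs => ?_
  rw [Real.norm_eq_abs]
  calc |s ^ (2 * l + 2) * ĝ s| ≤ K * s ^ (l + 2) := abs_momentIntegrand_le hK hs.1
    _ ≤ K * r ^ (l + 2) := by
        gcongr
        · exact nonneg_of_ampBound hK
        · exact hs.1.le
        · exact hs.2

/-- FTC: `F′(r) = r^{2l+2} ĝ(r)` for `r > 0`. [folklore] -/
theorem moment_hasDerivAt (hĝ : ContinuousOn ĝ (Ioi 0)) (hK : ∀ r, 0 < r → |ĝ r| * r ^ l ≤ K)
    (hF : F = fun r => ∫ s in (0 : ℝ)..r, s ^ (2 * l + 2) * ĝ s) {r : ℝ} (hr : 0 < r) :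
    HasDerivAt F (r ^ (2 * l + 2) * ĝ r) r := by
  have hc := continuousOn_momentIntegrand (l := l) hĝ
  rw [hF]
  exact integral_hasDerivAt_right (intervalIntegrable_momentIntegrand hĝ hK hr)
    (hc.stronglyMeasurableAtFilter isOpen_Ioi r hr) (hc.continuousAt (Ioi_mem_nhds hr))

/-- `|F(r)| ≤ K r^{l+3}` for `r > 0`. [folklore] -/
theorem abs_moment_le (hK : ∀ r, 0 < r → |ĝ r| * r ^ l ≤ K)
    (hF : F = fun r => ∫ s in (0 : ℝ)..r, s ^ (2 * l + 2) * ĝ s) {r : ℝ} (hr : 0 < r) :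
    |F r| ≤ K * r ^ (l + 3) := by
  have h : ∀ s ∈ Ι (0 : ℝ) r, ‖s ^ (2 * l + 2) * ĝ s‖ ≤ K * r ^ (l + 2) := by
    intro s hs
    rw [uIoc_of_le hr.le] at hs
    rw [Real.norm_eq_abs]
    calc |s ^ (2 * l + 2) * ĝ s| ≤ K * s ^ (l + 2) := abs_momentIntegrand_le hK hs.1
      _ ≤ K * r ^ (l + 2) := by
          gcongr
          · exact nonneg_of_ampBound hK
          · exact hs.1.le
          · exact hs.2
  have h2 := norm_integral_le_of_norm_le_const h
  rw [sub_zero, abs_of_pos hr, Real.norm_eq_abs] at h2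
  rw [hF]
  calc |∫ s in (0 : ℝ)..r, s ^ (2 * l + 2) * ĝ s| ≤ K * r ^ (l + 2) * r := h2
    _ = K * r ^ (l + 3) := by ring

/-! ### The amplitude `a = l F / r^{2l+3}`: derivative, the radial ODE, the bound -/

/-- `a` is differentiable on `(0,∞)` with `a′(r) = l ĝ(r)/r − (2l+3) a(r)/r`. [folklore] -/
theorem amp_hasDerivAt (hĝ : ContinuousOn ĝ (Ioi 0)) (hK : ∀ r, 0 < r → |ĝ r| * r ^ l ≤ K)
    (hF : F = fun r => ∫ s in (0 : ℝ)..r, s ^ (2 * l + 2) * ĝ s) (ha : a = fun r => (l : ℝ) * F r / r ^ (2 * l + 3))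
    {r : ℝ} (hr : 0 < r) :
    HasDerivAt a ((l : ℝ) * ĝ r / r - (2 * l + 3) * a r / r) r := by
  have hFd := moment_hasDerivAt hĝ hK hF hr
  have hr0 : r ≠ 0 := hr.ne'
  have hpow : HasDerivAt (fun s : ℝ => s ^ (2 * l + 3)) (((2 * l + 3 : ℕ) : ℝ) * r ^ (2 * l + 3 - 1)) r := hasDerivAt_pow _ r
  rw [show 2 * l + 3 - 1 = 2 * l + 2 by omega] at hpow
  have hne : r ^ (2 * l + 3) ≠ 0 := pow_ne_zero _ hr0
  have h := (hFd.const_mul (l : ℝ)).fun_div hpow hne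
  rw [ha]
  refine h.congr_deriv ?_
  push_cast
  field_simp
  ring

/-- ★ THE RADIAL ODE: `r a′(r) = l ĝ(r) − (2l+3) a(r)` for `r > 0`. [folklore] -/
theorem amp_ode (hĝ : ContinuousOn ĝ (Ioi 0)) (hK : ∀ r, 0 < r → |ĝ r| * r ^ l ≤ K)
    (hF : F = fun r => ∫ s in (0 : ℝ)..r, s ^ (2 * l + 2) * ĝ s) (ha : a = fun r => (l : ℝ) * F r / r ^ (2 * l + 3))
    {r : ℝ} (hr : 0 < r) : r * deriv a r = (l : ℝ) * ĝ r - (2 * l + 3) * a r := by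
  rw [(amp_hasDerivAt hĝ hK hF ha hr).deriv]
  field_simp

/-- CENTRE/INFINITY BOUND: `|a(r)|·r^l ≤ l K` for every `r > 0`. [folklore] -/
theorem abs_amp_mul_pow_le (hK : ∀ r, 0 < r → |ĝ r| * r ^ l ≤ K)
    (hF : F = fun r => ∫ s in (0 : ℝ)..r, s ^ (2 * l + 2) * ĝ s) (ha : a = fun r => (l : ℝ) * F r / r ^ (2 * l + 3))
    {r : ℝ} (hr : 0 < r) : |a r| * r ^ l ≤ (l : ℝ) * K := by
  have hFb := abs_moment_le hK hF hr
  have hr23 : 0 < r ^ (2 * l + 3) := pow_pos hr _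
  rw [ha]
  dsimp only
  rw [abs_div, abs_mul, abs_of_pos hr23, Nat.abs_cast, div_mul_eq_mul_div, div_le_iff₀ hr23]
  calc (l : ℝ) * |F r| * r ^ l ≤ (l : ℝ) * (K * r ^ (l + 3)) * r ^ l := by gcongr
    _ = (l : ℝ) * K * r ^ (2 * l + 3) := by ring

/-! ### The coefficient `k = k₁ + ∫₁^r s(a − ĝ)`: derivative, the two relations -/

/-- `k′(s) = s(a(s) − ĝ(s))` is continuous on `(0,∞)`. [folklore] -/
theorem continuousOn_coefDeriv (hĝ : ContinuousOn ĝ (Ioi 0)) (hK : ∀ r, 0 < r → |ĝ r| * r ^ l ≤ K)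
    (hF : F = fun r => ∫ s in (0 : ℝ)..r, s ^ (2 * l + 2) * ĝ s) (ha : a = fun r => (l : ℝ) * F r / r ^ (2 * l + 3)) :
    ContinuousOn (fun s => s * (a s - ĝ s)) (Ioi 0) := by
  have hac : ContinuousOn a (Ioi 0) := fun r hr =>
    (amp_hasDerivAt hĝ hK hF ha hr).differentiableAt.continuousAt.continuousWithinAt
  exact continuousOn_id.mul (hac.sub hĝ)

/-- FTC: `k′(r) = r (a(r) − ĝ(r))` for `r > 0`. [folklore] -/
theorem coef_hasDerivAt (hĝ : ContinuousOn ĝ (Ioi 0)) (hK : ∀ r, 0 < r → |ĝ r| * r ^ l ≤ K)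
    (hF : F = fun r => ∫ s in (0 : ℝ)..r, s ^ (2 * l + 2) * ĝ s) (ha : a = fun r => (l : ℝ) * F r / r ^ (2 * l + 3))
    (hk : k = fun r => k₁ + ∫ s in (1 : ℝ)..r, s * (a s - ĝ s)) {r : ℝ} (hr : 0 < r) :
    HasDerivAt k (r * (a r - ĝ r)) r := by
  have hc := continuousOn_coefDeriv hĝ hK hF ha
  have hint : IntervalIntegrable (fun s => s * (a s - ĝ s)) volume 1 r := by
    refine (hc.mono ?_).intervalIntegrable
    intro s hs
    rw [uIcc_eq_union] at hs
    rcases hs with hs | hs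
    · exact lt_of_lt_of_le one_pos hs.1
    · exact lt_of_lt_of_le hr hs.1
  have h := integral_hasDerivAt_right hint (hc.stronglyMeasurableAtFilter isOpen_Ioi r hr)
    (hc.continuousAt (Ioi_mem_nhds hr))
  rw [hk]
  exact h.const_add k₁

/-- ★ hG: `ĝ(r) = a(r) − k′(r)/r` for `r > 0`. [folklore] -/
theorem vortAmp_eq_amp_sub (hĝ : ContinuousOn ĝ (Ioi 0)) (hK : ∀ r, 0 < r → |ĝ r| * r ^ l ≤ K)
    (hF : F = fun r => ∫ s in (0 : ℝ)..r, s ^ (2 * l + 2) * ĝ s) (ha : a = fun r => (l : ℝ) * F r / r ^ (2 * l + 3))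
    (hk : k = fun r => k₁ + ∫ s in (1 : ℝ)..r, s * (a s - ĝ s)) {r : ℝ} (hr : 0 < r) :
    ĝ r = a r - deriv k r / r := by
  rw [(coef_hasDerivAt hĝ hK hF ha hk hr).deriv]
  field_simp
  ring

/-- ★ hdiv: the divergence relation `r a′ + (l+3) a + l k′/r = 0` for `r > 0`. [folklore] -/
theorem radial_divergence_relation (hĝ : ContinuousOn ĝ (Ioi 0)) (hK : ∀ r, 0 < r → |ĝ r| * r ^ l ≤ K)
    (hF : F = fun r => ∫ s in (0 : ℝ)..r, s ^ (2 * l + 2) * ĝ s) (ha : a = fun r => (l : ℝ) * F r / r ^ (2 * l + 3))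
    (hk : k = fun r => k₁ + ∫ s in (1 : ℝ)..r, s * (a s - ĝ s)) {r : ℝ} (hr : 0 < r) :
    r * deriv a r + ((l : ℝ) + 3) * a r + (l : ℝ) * deriv k r / r = 0 := by
  rw [amp_ode hĝ hK hF ha hr, (coef_hasDerivAt hĝ hK hF ha hk hr).deriv]
  field_simp
  ring
/-! ### Smoothness on `(0,∞)` -/

/-- `ĝ ∈ C^∞(0,∞) ⟹ F ∈ C^∞(0,∞)`. [folklore] -/
theorem moment_contDiffOn (hĝ : ContDiffOn ℝ ∞ ĝ (Ioi 0)) (hK : ∀ r, 0 < r → |ĝ r| * r ^ l ≤ K)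
    (hF : F = fun r => ∫ s in (0 : ℝ)..r, s ^ (2 * l + 2) * ĝ s) : ContDiffOn ℝ ∞ F (Ioi 0) := by
  have hd : ∀ r ∈ Ioi (0 : ℝ), HasDerivAt F (r ^ (2 * l + 2) * ĝ r) r := fun r hr =>
    moment_hasDerivAt hĝ.continuousOn hK hF hr
  rw [contDiffOn_infty_iff_deriv_of_isOpen isOpen_Ioi]
  refine ⟨fun r hr => (hd r hr).differentiableAt.differentiableWithinAt, ?_⟩
  have hI : ContDiffOn ℝ ∞ (fun s : ℝ => s ^ (2 * l + 2) * ĝ s) (Ioi 0) := (contDiff_id.pow _).contDiffOn.mul hĝ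
  exact hI.congr fun r hr => (hd r hr).deriv

/-- `ĝ ∈ C^∞(0,∞) ⟹ a ∈ C^∞(0,∞)`. [folklore] -/
theorem amp_contDiffOn (hĝ : ContDiffOn ℝ ∞ ĝ (Ioi 0)) (hK : ∀ r, 0 < r → |ĝ r| * r ^ l ≤ K)
    (hF : F = fun r => ∫ s in (0 : ℝ)..r, s ^ (2 * l + 2) * ĝ s) (ha : a = fun r => (l : ℝ) * F r / r ^ (2 * l + 3)) :
    ContDiffOn ℝ ∞ a (Ioi 0) := by
  rw [ha]
  exact ((contDiffOn_const (c := (l : ℝ))).mul (moment_contDiffOn hĝ hK hF)).div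
    ((contDiff_id.pow (2 * l + 3)).contDiffOn) (fun r (hr : 0 < r) => pow_ne_zero _ hr.ne')

/-- `ĝ ∈ C^∞(0,∞) ⟹ k ∈ C^∞(0,∞)`. [folklore] -/
theorem coef_contDiffOn (hĝ : ContDiffOn ℝ ∞ ĝ (Ioi 0)) (hK : ∀ r, 0 < r → |ĝ r| * r ^ l ≤ K)
    (hF : F = fun r => ∫ s in (0 : ℝ)..r, s ^ (2 * l + 2) * ĝ s) (ha : a = fun r => (l : ℝ) * F r / r ^ (2 * l + 3))
    (hk : k = fun r => k₁ + ∫ s in (1 : ℝ)..r, s * (a s - ĝ s)) : ContDiffOn ℝ ∞ k (Ioi 0) := by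
  have hd : ∀ r ∈ Ioi (0 : ℝ), HasDerivAt k (r * (a r - ĝ r)) r := fun r hr =>
    coef_hasDerivAt hĝ.continuousOn hK hF ha hk hr
  rw [contDiffOn_infty_iff_deriv_of_isOpen isOpen_Ioi]
  refine ⟨fun r hr => (hd r hr).differentiableAt.differentiableWithinAt, ?_⟩
  have hI : ContDiffOn ℝ ∞ (fun s => s * (a s - ĝ s)) (Ioi 0) := contDiffOn_id.mul ((amp_contDiffOn hĝ hK hF ha).sub hĝ)
  exact hI.congr fun r hr => (hd r hr).deriv
/-! ### Growth of `k` -/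

/-- `|k′(s)| ≤ (l+1)K / s^{l−1}` for `s > 0` (`l ≥ 1`). [folklore] -/
theorem abs_coefDeriv_le (hK : ∀ r, 0 < r → |ĝ r| * r ^ l ≤ K)
    (hF : F = fun r => ∫ s in (0 : ℝ)..r, s ^ (2 * l + 2) * ĝ s) (ha : a = fun r => (l : ℝ) * F r / r ^ (2 * l + 3))
    (hl : 1 ≤ l) {s : ℝ} (hs : 0 < s) : |s * (a s - ĝ s)| ≤ ((l : ℝ) + 1) * K / s ^ (l - 1) := by
  have hab := abs_amp_mul_pow_le hK hF ha hs
  have hg := hK s hs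
  have hsl1 : 0 < s ^ (l - 1) := pow_pos hs _
  rw [le_div_iff₀ hsl1, abs_mul, abs_of_pos hs]
  have hpow : s * s ^ (l - 1) = s ^ l := by
    rw [← pow_succ']
    congr 1
    omega
  calc s * |a s - ĝ s| * s ^ (l - 1) = |a s - ĝ s| * (s * s ^ (l - 1)) := by ring
    _ = |a s - ĝ s| * s ^ l := by rw [hpow]
    _ ≤ (|a s| + |ĝ s|) * s ^ l := by gcongr; exact abs_sub _ _
    _ = |a s| * s ^ l + |ĝ s| * s ^ l := by ring
    _ ≤ (l : ℝ) * K + K := add_le_add hab hg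
    _ = ((l : ℝ) + 1) * K := by ring

/-- `l = 2`, `k₁ = 0`: `|k(r)| ≤ 3K·|log r|` for `r > 0`. [folklore] -/
theorem abs_coef_le_log {ĝ F a k : ℝ → ℝ} (hĝ : ContinuousOn ĝ (Ioi 0)) (hK : ∀ r, 0 < r → |ĝ r| * r ^ 2 ≤ K)
    (hF : F = fun r => ∫ s in (0 : ℝ)..r, s ^ (2 * 2 + 2) * ĝ s) (ha : a = fun r => ((2 : ℕ) : ℝ) * F r / r ^ (2 * 2 + 3))
    (hk : k = fun r => 0 + ∫ s in (1 : ℝ)..r, s * (a s - ĝ s)) {r : ℝ} (hr : 0 < r) :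
    |k r| ≤ 3 * K * |Real.log r| := by
  have hc := continuousOn_coefDeriv hĝ hK hF ha
  have hK0 := nonneg_of_ampBound hK
  -- `|k′(s)| ≤ 3K/s`
  have hb : ∀ s, 0 < s → |s * (a s - ĝ s)| ≤ 3 * K * s⁻¹ := by
    intro s hs
    calc |s * (a s - ĝ s)| ≤ (((2 : ℕ) : ℝ) + 1) * K / s ^ (2 - 1) := abs_coefDeriv_le hK hF ha (by norm_num) hs
      _ = 3 * K * s⁻¹ := by rw [div_eq_mul_inv]; norm_num
  rw [hk]
  dsimp only
  rw [zero_add]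
  rcases le_or_gt 1 r with h1 | h1
  · -- `1 ≤ r`
    have h := norm_integral_le_of_norm_le h1 (f := fun s => s * (a s - ĝ s)) (g := fun s => 3 * K * s⁻¹) (μ := volume)
      (Eventually.of_forall fun s hs => by rw [Real.norm_eq_abs]; exact hb s (lt_of_lt_of_le one_pos hs.1.le))
      (((continuousOn_const.mul (continuousOn_inv₀.mono fun s (hs : s ∈ Icc 1 r) => (lt_of_lt_of_le one_pos hs.1).ne')).mono
        (by rw [uIcc_of_le h1])).intervalIntegrable)
    rw [Real.norm_eq_abs] at h
    refine h.trans ?_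
    rw [intervalIntegral.integral_const_mul, integral_inv_of_pos one_pos hr, div_one,
      abs_of_nonneg (Real.log_nonneg h1)]
  · -- `r < 1`
    have h := norm_integral_le_of_norm_le h1.le (f := fun s => s * (a s - ĝ s)) (g := fun s => 3 * K * s⁻¹) (μ := volume)
      (Eventually.of_forall fun s hs => by rw [Real.norm_eq_abs]; exact hb s (lt_trans hr hs.1))
      (((continuousOn_const.mul (continuousOn_inv₀.mono fun s (hs : s ∈ Icc r 1) =>
        (lt_of_lt_of_le hr hs.1).ne')).mono (by rw [uIcc_of_le h1.le])).intervalIntegrable)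
    rw [integral_symm, norm_neg, Real.norm_eq_abs] at h
    refine h.trans ?_
    rw [intervalIntegral.integral_const_mul, integral_inv_of_pos hr one_pos, one_div, Real.log_inv,
      abs_of_neg (Real.log_neg hr h1)]

/-- `l ≥ 3`: `k′` is integrable on `(c, ∞)` for every `c > 0`, dominated by `(l+1)K·s^{−(l−1)}`. [folklore] -/
theorem integrableOn_coefDeriv_Ioi (hĝ : ContinuousOn ĝ (Ioi 0)) (hK : ∀ r, 0 < r → |ĝ r| * r ^ l ≤ K)
    (hF : F = fun r => ∫ s in (0 : ℝ)..r, s ^ (2 * l + 2) * ĝ s) (ha : a = fun r => (l : ℝ) * F r / r ^ (2 * l + 3))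
    (hl : 3 ≤ l) {c : ℝ} (hc : 0 < c) :
    IntegrableOn (fun s => s * (a s - ĝ s)) (Ioi c) ∧
      ∀ᵐ s ∂(volume.restrict (Ioi c)), ‖s * (a s - ĝ s)‖ ≤ ((l : ℝ) + 1) * K * s ^ (-((l : ℝ) - 1)) := by
  have hcont := continuousOn_coefDeriv hĝ hK hF ha
  have hmeas : AEStronglyMeasurable (fun s => s * (a s - ĝ s)) (volume.restrict (Ioi c)) :=
    (hcont.mono (Ioi_subset_Ioi hc.le)).aestronglyMeasurable measurableSet_Ioi
  have hexp : (-((l : ℝ) - 1)) < -1 := by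
    have : (3 : ℝ) ≤ l := by exact_mod_cast hl
    linarith
  have hg : IntegrableOn (fun s : ℝ => ((l : ℝ) + 1) * K * s ^ (-((l : ℝ) - 1))) (Ioi c) :=
    (integrableOn_Ioi_rpow_of_lt hexp hc).const_mul _
  have hbound : ∀ᵐ s ∂(volume.restrict (Ioi c)), ‖s * (a s - ĝ s)‖ ≤ ((l : ℝ) + 1) * K * s ^ (-((l : ℝ) - 1)) := by
    rw [ae_restrict_iff' measurableSet_Ioi]
    refine Eventually.of_forall fun s (hs : c < s) => ?_
    have hs0 : 0 < s := hc.trans hs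
    rw [Real.norm_eq_abs]
    have h := abs_coefDeriv_le hK hF ha (by omega) hs0
    have hpow : s ^ (-((l : ℝ) - 1)) = (s ^ (l - 1))⁻¹ := by
      rw [Real.rpow_neg hs0.le, show ((l : ℝ) - 1) = ((l - 1 : ℕ) : ℝ) by
        push_cast [Nat.cast_sub (by omega : 1 ≤ l)]; ring, Real.rpow_natCast]
    rw [hpow, ← div_eq_mul_inv]
    exact h
  exact ⟨Integrable.mono' hg hmeas hbound, hbound⟩

/-- `l ≥ 3`, `k₁ = −∫₁^∞ k′`: `|k(r)|·r^{l−2} ≤ (l+1)K/(l−2)` for `r > 0` (`k(r) = −∫_r^∞ k′`). [folklore] -/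
theorem abs_coef_decay_mul_pow_le (hĝ : ContinuousOn ĝ (Ioi 0)) (hK : ∀ r, 0 < r → |ĝ r| * r ^ l ≤ K)
    (hF : F = fun r => ∫ s in (0 : ℝ)..r, s ^ (2 * l + 2) * ĝ s) (ha : a = fun r => (l : ℝ) * F r / r ^ (2 * l + 3))
    (hk : k = fun r => (-∫ s in Ioi 1, s * (a s - ĝ s)) + ∫ s in (1 : ℝ)..r, s * (a s - ĝ s)) (hl : 3 ≤ l) {r : ℝ}
    (hr : 0 < r) : |k r| * r ^ (l - 2) ≤ ((l : ℝ) + 1) * K / ((l : ℝ) - 2) := by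
  -- `k(r) = −∫_r^∞ k′`
  have hkr : k r = -∫ s in Ioi r, s * (a s - ĝ s) := by
    rw [hk]
    dsimp only
    rw [← integral_Ioi_sub_Ioi' (integrableOn_coefDeriv_Ioi hĝ hK hF ha hl one_pos).1
      (integrableOn_coefDeriv_Ioi hĝ hK hF ha hl hr).1]
    ring
  rw [hkr, abs_neg]
  have hl3 : (3 : ℝ) ≤ l := by exact_mod_cast hl
  have hexp : (-((l : ℝ) - 1)) < -1 := by linarith
  have hK0 := nonneg_of_ampBound hK
  have hg : IntegrableOn (fun s : ℝ => ((l : ℝ) + 1) * K * s ^ (-((l : ℝ) - 1))) (Ioi r) :=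
    (integrableOn_Ioi_rpow_of_lt hexp hr).const_mul _
  have h1 : ‖∫ s in Ioi r, s * (a s - ĝ s)‖ ≤ ∫ s in Ioi r, ((l : ℝ) + 1) * K * s ^ (-((l : ℝ) - 1)) :=
    norm_integral_le_of_norm_le hg (integrableOn_coefDeriv_Ioi hĝ hK hF ha hl hr).2
  rw [Real.norm_eq_abs, MeasureTheory.integral_const_mul, integral_Ioi_rpow_of_lt hexp hr] at h1
  have hsimp : -r ^ (-((l : ℝ) - 1) + 1) / (-((l : ℝ) - 1) + 1) = r ^ (-((l : ℝ) - 2)) / ((l : ℝ) - 2) := by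
    rw [show -((l : ℝ) - 1) + 1 = -((l : ℝ) - 2) by ring]
    field_simp
  rw [hsimp] at h1
  have hpow : r ^ (-((l : ℝ) - 2)) = (r ^ (l - 2))⁻¹ := by
    rw [Real.rpow_neg hr.le, show ((l : ℝ) - 2) = ((l - 2 : ℕ) : ℝ) by
      push_cast [Nat.cast_sub (by omega : 2 ≤ l)]; ring, Real.rpow_natCast]
  rw [hpow] at h1
  have hrl : 0 < r ^ (l - 2) := pow_pos hr _
  have hl2 : 0 < (l : ℝ) - 2 := by linarith
  calc |∫ s in Ioi r, s * (a s - ĝ s)| * r ^ (l - 2)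
      ≤ ((l : ℝ) + 1) * K * ((r ^ (l - 2))⁻¹ / ((l : ℝ) - 2)) * r ^ (l - 2) := by gcongr
    _ = ((l : ℝ) + 1) * K / ((l : ℝ) - 2) := by field_simp
/-! ### ★★ The export -/

/-- ★★ **THE RADIAL PROFILES OF THE EVEN RUNG.**  Let `l ≥ 2` and let `ĝ ∈ C^∞(0,∞)` satisfy the amplitude bound `|ĝ(r)|·r^l ≤ K` for all
`r > 0`.  Then there are `a k ∈ C^∞(0,∞)` with, for every `r > 0`: `ĝ(r) = a(r) − k′(r)/r` (hG), `r a′(r) + (l+3) a(r) + l k′(r)/r = 0`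
(hdiv), `|a(r)|·r^l ≤ C`, and `|k(r)|·r^{l−1} ≤ C·r·(1 + |log r|)` — the letters of `singleDegreeRung_of_sliceData` and the two bounds that
make `V = (aP)•y + k•∇P` vanish at the centre and grow at most like `r log r`.  [`a = l F/r^{2l+3}`, `F = ∫₀^r s^{2l+2}ĝ`,
`k = k₁ + ∫₁^r s(a − ĝ)` with `k₁ = 0` for `l = 2` and `k₁ = −∫₁^∞ s(a − ĝ)` for `l ≥ 3`.] [folklore] -/
theorem exists_radialProfiles (hl : 2 ≤ l) (hĝ : ContDiffOn ℝ ∞ ĝ (Ioi 0)) (hK : ∀ r, 0 < r → |ĝ r| * r ^ l ≤ K) :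
    ∃ a k : ℝ → ℝ, ContDiffOn ℝ ∞ a (Ioi 0) ∧ ContDiffOn ℝ ∞ k (Ioi 0) ∧
      (∀ r, 0 < r → ĝ r = a r - deriv k r / r) ∧
      (∀ r, 0 < r → r * deriv a r + ((l : ℝ) + 3) * a r + (l : ℝ) * deriv k r / r = 0) ∧
      ∃ C : ℝ, (∀ r, 0 < r → |a r| * r ^ l ≤ C) ∧
        (∀ r, 0 < r → |k r| * r ^ (l - 1) ≤ C * r * (1 + |Real.log r|)) := by
  have hĝc : ContinuousOn ĝ (Ioi 0) := hĝ.continuousOn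
  have hK0 := nonneg_of_ampBound hK
  -- the objects, by defining equations
  set F : ℝ → ℝ := fun r => ∫ s in (0 : ℝ)..r, s ^ (2 * l + 2) * ĝ s with hF
  set a : ℝ → ℝ := fun r => (l : ℝ) * F r / r ^ (2 * l + 3) with ha
  rcases Nat.lt_or_ge l 3 with h2 | h3
  · -- `l = 2`, `k₁ = 0`
    obtain rfl : l = 2 := by omega
    set k : ℝ → ℝ := fun r => 0 + ∫ s in (1 : ℝ)..r, s * (a s - ĝ s) with hk
    refine ⟨a, k, amp_contDiffOn hĝ hK hF ha, coef_contDiffOn hĝ hK hF ha hk,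
      fun r hr => vortAmp_eq_amp_sub hĝc hK hF ha hk hr, fun r hr => ?_, max (2 * K) (3 * K), fun r hr => ?_,
      fun r hr => ?_⟩
    · have h := radial_divergence_relation hĝc hK hF ha hk hr
      push_cast at h ⊢
      exact h
    · exact (abs_amp_mul_pow_le hK hF ha hr).trans (by push_cast; exact le_max_left _ _)
    · have h := abs_coef_le_log hĝc hK hF ha hk hr
      have hlog : 0 ≤ |Real.log r| := abs_nonneg _
      calc |k r| * r ^ (2 - 1) = |k r| * r := by norm_num
        _ ≤ 3 * K * |Real.log r| * r := by gcongr
        _ ≤ max (2 * K) (3 * K) * |Real.log r| * r := by gcongr; exact le_max_right _ _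
        _ ≤ max (2 * K) (3 * K) * r * (1 + |Real.log r|) := by
            have h3 : 3 * K ≤ max (2 * K) (3 * K) := le_max_right _ _
            have hm : 0 ≤ max (2 * K) (3 * K) := le_trans (by positivity) h3
            nlinarith [mul_nonneg hm hr.le]
  · -- `l ≥ 3`, `k₁ = −∫₁^∞ k′`
    set k : ℝ → ℝ := fun r => (-∫ s in Ioi 1, s * (a s - ĝ s)) + ∫ s in (1 : ℝ)..r, s * (a s - ĝ s) with hk
    refine ⟨a, k, amp_contDiffOn hĝ hK hF ha, coef_contDiffOn hĝ hK hF ha hk,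
      fun r hr => vortAmp_eq_amp_sub hĝc hK hF ha hk hr, fun r hr => radial_divergence_relation hĝc hK hF ha hk hr,
      max ((l : ℝ) * K) (((l : ℝ) + 1) * K / ((l : ℝ) - 2)), fun r hr => ?_, fun r hr => ?_⟩
    · exact (abs_amp_mul_pow_le hK hF ha hr).trans (le_max_left _ _)
    · have h := abs_coef_decay_mul_pow_le hĝc hK hF ha hk h3 hr
      have hl3 : (3 : ℝ) ≤ l := by exact_mod_cast h3
      have hM : ((l : ℝ) + 1) * K / ((l : ℝ) - 2) ≤ max ((l : ℝ) * K) (((l : ℝ) + 1) * K / ((l : ℝ) - 2)) :=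
        le_max_right _ _
      have hMnn : 0 ≤ max ((l : ℝ) * K) (((l : ℝ) + 1) * K / ((l : ℝ) - 2)) :=
        le_trans (div_nonneg (by positivity) (by linarith)) hM
      have hpow : r ^ (l - 1) = r ^ (l - 2) * r := by
        rw [← pow_succ]
        congr 1
        omega
      have hlog : 0 ≤ |Real.log r| := abs_nonneg _
      calc |k r| * r ^ (l - 1) = (|k r| * r ^ (l - 2)) * r := by rw [hpow]; ring
        _ ≤ ((l : ℝ) + 1) * K / ((l : ℝ) - 2) * r := by gcongr
        _ ≤ max ((l : ℝ) * K) (((l : ℝ) + 1) * K / ((l : ℝ) - 2)) * r * (1 + |Real.log r|) := by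
            nlinarith [mul_nonneg hMnn hr.le, mul_nonneg (mul_nonneg hMnn hr.le) hlog]

end Summit.NavierStokesRegularity.NavierStokesRegularity.Theorems.PoloidalLiouville.Antidynamo

end
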